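import Mathlib
import Summits.Ventures.HodgeRepro2.T5AdicCompletionUnitIndex
import Summits.Ventures.HodgeRepro2.T5EisensteinField
import Summits.Ventures.HodgeRepro2.T5EisensteinInertPlace
import Summits.Ventures.HodgeRepro2.T5ConcretePlaces
import Summits.Ventures.HodgeRepro2.T6N5LocalHypSmooth
import Summits.Ventures.HodgeRepro2.T6N5LocalSmooth
import Summits.Ventures.HodgeRepro2.T6N5LocalWeilQuotient
import Summits.Ventures.HodgeRepro2.T6N5LocalWeilQuotientSmooth
import Summits.Ventures.HodgeRepro2.T6N5LocalQuotientToy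
import Summits.Ventures.HodgeRepro2.T6N5LocalRamWitness
import Summits.Ventures.HodgeRepro2.T6N5LocalInertToyEps
import Summits.Ventures.HodgeRepro2.T6N5LocalInertToyEpsDisplays

/-!
# T6N5LocalInertWitness — Tier 6, M2 sub-step N5 (t6-p8's half): THE COMPLETION-LEVEL WITNESS (README §10.5(ii)(c),(d))
for the INERT statement of record v2 — every hypothesis of `N5Local_main_inert_completion_weil''` instantiated jointly
on Mathlib's completions at ANY inert place, and on the concrete place `ℚ(ζ₃)/ℚ` at `2`

The inert counterpart of `T6N5LocalRamWitness`: over `Q : InertPlace v w` (`T6N5LocalInertToyEps`), the toy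
parameters `toyP` (the toy ε-factor satisfying Tate's (3.2.2)–(3.2.3) and GGP's Prop. 3.1), the datum's `ψ_δ := ψ₁`
(the normalised character of Lemma N5.L5, trivial on `K_v`), and the quotient Weil toy `weilT` with
`sgn = ε_v(χ_W⁻¹ ·)` satisfy EVERY hypothesis of the statement of record v2 (the inertia degree `≥ 2`, the displays
`hG` / `hT` / `h35`, finite-index and open smoothness, non-vanishing, `ϵ_δ(W) = 1`, `χ_W = μ` conjugate-symplectic), so
the coupled local system is solved (`exists_localSolution_inert`); `eisenstein_inert_witness` instantiates it on
`ℚ₂ ⊆ ℚ₂(ω)` (p4's `T5EisensteinInertPlace.hypotheses_satisfiable`, `T5ConcretePlaces.inert`).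
README §8(d): uses an L-value-free non-vanishing device: NO.
-/

namespace Summit.Ventures.HodgeRepro2.T6.N5LocalInertWitness

open Summit.Ventures.HodgeRepro2 IsDedekindDomain HeightOneSpectrum
  Summit.Ventures.HodgeRepro2.T6.N5LocalDatum Summit.Ventures.HodgeRepro2.T6.N5LocalWeil
  Summit.Ventures.HodgeRepro2.T6.N5LocalCharDatum Summit.Ventures.HodgeRepro2.T6.N5Local
  Summit.Ventures.HodgeRepro2.T6.N5LocalSmooth Summit.Ventures.HodgeRepro2.T6.N5LocalInertWeil
  Summit.Ventures.HodgeRepro2.T6.Hyp Summit.Ventures.HodgeRepro2.T6.N5LocalInertCompletion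
  Summit.Ventures.HodgeRepro2.T6.N5LocalInertOnCompletion Summit.Ventures.HodgeRepro2.T6.N5LocalTateChars
  Summit.Ventures.HodgeRepro2.T6.N5LocalInertTateSide Summit.Ventures.HodgeRepro2.T6.N5LocalOnCompletionWeil
  Summit.Ventures.HodgeRepro2.T6.N5LocalWeilQuotient Summit.Ventures.HodgeRepro2.T6.N5LocalWeilQuotientSmooth
  Summit.Ventures.HodgeRepro2.T6.N5LocalQuotientToy Summit.Ventures.HodgeRepro2.T6.N5LocalInertToyEps
  Summit.Ventures.HodgeRepro2.T6.N5LocalRamWitness Summit.Ventures.HodgeRepro2.T5SmoothIsotypic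

-- `K`, `L` in `Type` (universe `0`).
variable {K : Type} [Field K] [NumberField K] {v : HeightOneSpectrum (NumberField.RingOfIntegers K)}
  {L : Type} [Field L] [NumberField L] [Algebra K L] {w : HeightOneSpectrum (NumberField.RingOfIntegers L)}
  [w.asIdeal.LiesOver v.asIdeal]
  [ContinuousSMul (v.adicCompletion K) (w.adicCompletion L)]
  [IsScalarTower K (v.adicCompletion K) (w.adicCompletion L)]

noncomputable section

section Place

variable (Q : InertPlace v w)

/-- The sign function `ξ ↦ ε_v(χ_W⁻¹·ξ)` of the toy inert datum (`χ_W = μ`). -/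
abbrev sgnT : ((w.adicCompletion L)ˣ →* ℂˣ) → ℤˣ := fun ξ => Q.Dt.eps ((μ w)⁻¹ * ξ)

/-- The toy Weil representations over `U(V) = E_v^×/F_v^×` for the toy inert datum. -/
abbrev weilT : WeilRep v w := weilRep v w (U v w Q.ϖ) (sgnT Q)

/-- The toy inert Weil datum. -/
abbrev XT : InertWeilDatum :=
  mkInertWeil v w Q.h2 Q.hϖ Q.hϖS Q.σ Q.hσ Q.toyP Q.ψ₁ Q.ψ₁_algebraMap (toCarrier v w (weilT Q))

omit [IsScalarTower K (v.adicCompletion K) (w.adicCompletion L)] in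
/-- `[E_v^× : F_v^× U_E^n] < ∞` for every `n` (p4's `T5AdicCompletionUnitIndex`, with the uniformiser `alg ϖ` of
`L_w`). -/
theorem finiteIndex_Fsub_sup_U (n : ℕ) : (Fsub v w ⊔ U v w Q.ϖ n).FiniteIndex := by
  have hϖ' : Valued.v ((Q.ϖ : v.adicCompletionIntegers K) : v.adicCompletion K) = WithZero.exp (-1) :=
    (T5AdicCompletionConductor.irreducible_iff_val_eq_exp_neg_one v Q.ϖ).mp Q.hϖ
  have h1 : (Fsub v w ⊔ U v w Q.ϖ 1).FiniteIndex := by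
    haveI : Finite ((w.adicCompletion L)ˣ ⧸ (Fsub v w ⊔ U v w Q.ϖ 1)) :=
      T5AdicCompletionUnitIndex.finite_quotient_range_baseUnits_sup_map_higherUnits v w hϖ' Q.hϖS le_rfl
    exact Subgroup.finiteIndex_of_finite_quotient
  rcases Nat.eq_zero_or_pos n with hn | hn
  · subst hn
    exact Subgroup.finiteIndex_of_le (sup_le_sup_left (U_antitone v w Q.ϖ (Nat.zero_le 1)) _)
  · haveI : Finite ((w.adicCompletion L)ˣ ⧸ (Fsub v w ⊔ U v w Q.ϖ n)) :=
      T5AdicCompletionUnitIndex.finite_quotient_range_baseUnits_sup_map_higherUnits v w hϖ' Q.hϖS hn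
    exact Subgroup.finiteIndex_of_finite_quotient

omit [IsScalarTower K (v.adicCompletion K) (w.adicCompletion L)] in
/-- The defined theta predicate of the toy inert Weil datum is membership in `Good s`. -/
theorem thetaOf_iff (s : ℤˣ) (ξ : (w.adicCompletion L)ˣ →* ℂˣ) :
    (XT Q).toWeil.thetaOf s ξ ↔ ξ ∈ Good v w (U v w Q.ϖ) (sgnT Q) s := by
  constructor
  · rintro ⟨α, hα, hne⟩
    have hne' : isoQ v w (U v w Q.ϖ) (sgnT Q) s α ≠ ⊥ := hne
    have h := (isotypic_ne_bot_iff v w (U v w Q.ϖ) (sgnT Q) s α).mp hne'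
    have hα' : ofOneQ v w α = ξ := hα
    rwa [hα'] at h
  · intro h
    have hker : Fsub v w ≤ ξ.ker := fun f hf => MonoidHom.mem_ker.mpr (h.1 f hf)
    refine ⟨toAddCharQ ξ hker, ofOneQ_toAddCharQ ξ hker, ?_⟩
    show isoQ v w (U v w Q.ϖ) (sgnT Q) s (toAddCharQ ξ hker) ≠ ⊥
    rw [isotypic_ne_bot_iff, ofOneQ_toAddCharQ]
    exact h

omit [IsScalarTower K (v.adicCompletion K) (w.adicCompletion L)] in
/-- THE EPSILON DICHOTOMY (restricted to the print's characters) HOLDS for the defined theta predicate of the toy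
inert Weil datum. -/
theorem h35_toy : BFGYYZ2025_Thm3_5_smooth (XT Q).toWeil.toLocalSignDatum (XT Q).D.IsSmooth := by
  intro s α hα hαs
  change (w.adicCompletion L)ˣ →* ℂˣ at α
  have hCO : ∀ f ∈ Fsub v w, α f = 1 := fun f hf =>
    (CharDatum.isCO_iff Q.Dt.toCharDatum α).mp hα ⟨f, hf⟩
  have hs : ∃ n, U v w Q.ϖ n ≤ α.ker := hαs
  show (XT Q).toWeil.thetaOf s α ↔ Q.Dt.eps ((μ w)⁻¹ * α) = s * 1
  rw [thetaOf_iff, mul_one]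
  constructor
  · intro h
    exact h.2.2
  · intro h
    exact ⟨hCO, hs, h⟩

omit [IsScalarTower K (v.adicCompletion K) (w.adicCompletion L)] in
/-- Both signs occur on smooth conjugate-orthogonal characters: `Good s` is non-empty for every `s`. -/
theorem good_nonempty (s : ℤˣ) : ∃ ξ, ξ ∈ Good v w (U v w Q.ϖ) (sgnT Q) s := by
  obtain ⟨α, hα, hαs, heps⟩ := Q.exists_isCO_eps_inv_χW_mul_eq s
  change (w.adicCompletion L)ˣ →* ℂˣ at α
  refine ⟨α, fun f hf => (CharDatum.isCO_iff Q.Dt.toCharDatum α).mp hα ⟨f, hf⟩, hαs, ?_⟩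
  exact heps

omit [IsScalarTower K (v.adicCompletion K) (w.adicCompletion L)] in
/-- `χ_W = μ` of the toy datum is conjugate-symplectic. -/
theorem hχW_toy : (XT Q).toWeil.toLocalSignDatum.IsCS Q.toyP.χW :=
  (CharDatum.isCS_iff Q.Dt.toCharDatum _).mpr fun x => μ_eq_ηF v w Q.σ Q.hσ Q.h2 Q.hϖ Q.hϖS Q.hind ⟨x.1, x.2⟩

/-- THE WITNESS: every hypothesis of `N5Local_main_inert_completion_weil''` holds jointly on the toy data over an
inert place, and the coupled local system is solved there (Theorem N5.T2 instantiated on Mathlib's completions). -/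
theorem exists_localSolution_inert :
    ∃ ξ : Fin 4 → (w.adicCompletion L)ˣ →* ℂˣ, LocalSolution (XT Q).toWeil.toLocalSignDatum ξ := by
  haveI : ∀ s, Nontrivial ((weilT Q).Wsp s) := fun s =>
    nontrivial_wsp v w (U v w Q.ϖ) (sgnT Q) (good_nonempty Q) s
  exact N5Local_main_inert_completion_weil'' v w Q.h2 Q.hϖ Q.hϖS Q.σ Q.hσ Q.toyP Q.ψ₁ Q.ψ₁_algebraMap (weilT Q)
    Q.hf (Q.hG_toy) (Q.hT_toy) (h35_toy Q)
    (fun s => isSmoothCompact v w (U v w Q.ϖ) (sgnT Q) (finiteIndex_Fsub_sup_U Q) s)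
    (fun s => isSmoothOpen v w (U v w Q.ϖ) (sgnT Q) (U_antitone v w Q.ϖ) s) rfl (hχW_toy Q)

end Place

/-! ### The concrete inert place `ℚ(ζ₃)/ℚ` at `2` -/

section Eisenstein

open T5GaussianField T5EisensteinField T5EisensteinInertPlace

/-- A place of `ℚ(ζ₃)` above `2` exists (p4's `T5ConcretePlaces.inert`). -/
theorem exists_place_above_two :
    ∃ w : HeightOneSpectrum (NumberField.RingOfIntegers L₃), w.asIdeal.LiesOver v₂.asIdeal :=
  T5ConcretePlaces.inert.1

variable (w : HeightOneSpectrum (NumberField.RingOfIntegers L₃)) [w.asIdeal.LiesOver v₂.asIdeal]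

/-- The inert place data of `ℚ₂ ⊆ ℚ₂(ω)` (p4's `T5EisensteinInertPlace.hypotheses_satisfiable`), bundled. -/
def eisensteinPlace : InertPlace v₂ w :=
  let h := T5EisensteinInertPlace.hypotheses_satisfiable w
  { h2 := h.1
    ϖ := Classical.choose h.2
    hϖ := (Classical.choose_spec h.2).1
    hϖS := (Classical.choose_spec h.2).2.1
    σ := Classical.choose (Classical.choose_spec h.2).2.2
    hσ := Classical.choose_spec (Classical.choose_spec h.2).2.2 }

/-- THE WITNESS ON `ℚ₂ ⊆ ℚ₂(ω)`: the coupled local system of Theorem N5.T2 is solved with every hypothesis of the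
inert statement of record v2 instantiated on the genuine carriers. -/
theorem eisenstein_inert_witness :
    ∃ ξ : Fin 4 → (w.adicCompletion L₃)ˣ →* ℂˣ,
      LocalSolution (XT (eisensteinPlace w)).toWeil.toLocalSignDatum ξ :=
  exists_localSolution_inert (eisensteinPlace w)

end Eisenstein

end

end Summit.Ventures.HodgeRepro2.T6.N5LocalInertWitness
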